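/-
Copyright (c) 2026. All rights reserved.
Released under Apache 2.0 license as described in the file LICENSE.
-/
import Literature.NumberTheory.ComplexMultiplication.DegenerateCMTypesCyclicTwoOddPrimes
import HarnessLib

/-!
# Hazama's degenerate CM types of a cyclic group of order `2pq`, III: the (0,1)-matrix of a type and the COUNTS
# `#S_p = Σ_i C(p,i)^q`, `#S_q = Σ_i C(q,i)^p`, `#S₁ = 2^p + 2^q − 2`, `#(S₁ ∩ S_p) = 2^p`, `#(S_p ∩ S_q) = 2`

Sequel of `DegenerateCMTypesCyclicTwoOddPrimes` (same frame `CyclicFrame p q ρ τ κ` on a finite commutative group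
`G = ⟨ρ⟩ × ⟨τ⟩ × ⟨κ⟩` of order `2pq`; Hazama's classes read as `S_p` = `HasConstantRows p q S τ κ`,
`S_q` = `HasConstantRows q p S κ τ`, `S₁` = `IsStableUnder S τ ∨ IsStableUnder S κ`, identifications PROVED there:
`sum_char_eq_zero_iff_hasConstantRows`, `sum_char_eq_zero_iff_isStableUnder`, `exists_isStableUnder_iff`).
F. Hazama, *Hodge cycles on abelian varieties with complex multiplication by cyclic CM-fields*, J. Math. Sci. Univ.
Tokyo **10** (2003) [Hazama2003CyclicCM] (held text `paper:w2141840783`), p. 588–590 and 595: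

> PROPOSITION 4.1. "The correspondence `S → E(S)` gives a bijection between the set of CM-types for `ℤ/2nℤ` and the
> set of `{±1}`-valued function on `ℤ/nℤ`."
> PROPOSITION 4.3. "There exists a natural bijection between the set `S_p` and the set of `q × p` `(0,1)`-matrices
> with constant row sum. Hence there are `Σ_{0≤i≤p} C(p,i)^q` such CM-types."  (proof, (4.5): "`#{a ∈ R_i ; e_a = 1}`
> does not depend on `i`, where `R_i = {a ; 0 ≤ a ≤ n − 1, a (mod q) = i}` … `z_{ij} = ν((−1)^{…} e_{(i−1)+(j−1)q})`")
> PROPOSITION 4.4. "… `S_q` and the set of `p × q` `(0,1)`-matrices with constant row sum. Hence there are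
> `Σ_{0≤i≤q} C(q,i)^p` such CM-types."
> PROPOSITION 4.5. "`S_p ∩ S_q = {S_even, S_odd}` … In particular, the CM-types in `S_p ∩ S_q` are not primitive."
> PROPOSITION 4.7 (p. 593). "`S₁ ∩ S_r = {S ∈ CM ; E(S) = Σ_i ε_i χ_i^{(r)} for some (ε_i) ∈ {±1}^r}` for `r = p`
> or `q`."
> THEOREM 4.8 (p. 594–595). "… Furthermore the numbers of elements of `S₁`, `S_p`, `S_q` and their intersections are
> given by `#(S₁) = 2^p + 2^q − 2`, `#(S_p) = Σ_{0≤i≤p} C(p,i)^q`, `#(S_q) = Σ_{0≤i≤q} C(q,i)^p`,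
> `#(S₁ ∩ S_p) = 2^p`, `#(S₁ ∩ S_q) = 2^q`, `#(S_p ∩ S_q) = #(S₁ ∩ S_p ∩ S_q) = 2`."
> §6 (p. 597–598): "the set of `Σ_{0≤i≤3} C(3,i)⁵ − 2³ = 480` of `3`-dominated absolutely simple abelian varieties with
> complex multiplication by `K₃₁`" and "`Σ_{0≤i≤5} C(5,i)³ − 2⁵ = 2220` of `5`-dominated".

## What is proved

* §1 `rowSet` (row `y` of Hazama's `(0,1)`-matrix: `{x ∈ ℤ/p : τˣκʸ ∈ S}`), `typeOfRows` (the type with prescribed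
  rows), `rowCount_eq_card_rowSet`, `pow_mul_pow_mem_typeOfRows_iff`, `rho_mul_mem_typeOfRows_iff`,
  `isCMTypeWith_typeOfRows`, `rowSet_typeOfRows`, `typeOfRows_rowSet` — PROP. 4.1: CM types for `ρ` correspond
  bijectively to row functions `r : ℤ/q → 𝒫(ℤ/p)` (= `(0,1)`-matrices, = sign vectors); `ncard_cmTypes` (there are
  `2^{pq}` CM types); the transport `ncard_cmTypes_sep_eq_card_filter`.
* §2 the dictionary: `hasConstantRows_iff_rowSet` (`S ∈ S_p` iff the rows have constant size),
  `isStableUnder_right_iff_rowSet` (`κS = S` iff all rows are equal — Prop. 4.7 for `r = p`),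
  `isStableUnder_left_iff_rowSet` (`τS = S` iff every row is `∅` or `ℤ/p` — Prop. 4.7 for `r = q`),
  `hasConstantCols_iff_rowSet`.
* §3 counting row functions: `card_filter_rows_card_const` (`Σ_i C(p,i)^q`), `card_filter_rows_const` (`2^p`),
  `card_filter_rows_trivial` (`2^q`), `card_filter_rows_const_and_trivial` (`2`), `card_filter_rows_const_or_trivial`
  (`2^p + 2^q − 2`).
* §4 THE COUNTS OF THEOREM 4.8: **`ncard_hasConstantRows`** (`#S_p = Σ_{i≤p} C(p,i)^q`, Prop. 4.3),
  **`ncard_hasConstantCols`** (`#S_q`, Prop. 4.4), **`ncard_stable`** (`#S₁ = 2^p + 2^q − 2`),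
  **`ncard_stable_and_hasConstantRows`** (`#(S₁ ∩ S_p) = 2^p`, Prop. 4.7), `ncard_stable_and_hasConstantCols`
  (`2^q`), **`ncard_hasConstantRows_and_hasConstantCols`** (`#(S_p ∩ S_q) = 2`, Prop. 4.5),
  **`ncard_primitive_hasConstantRows`** (the primitive `p`-dominated types number `Σ_i C(p,i)^q − 2^p`),
  `ncard_primitive_hasConstantCols` (`Σ_i C(q,i)^p − 2^q`), **`ncard_degenerate`**
  (`#Deg = Σ_i C(p,i)^q + Σ_i C(q,i)^p − 2`, since `S₁ ⊆ S_p ∪ S_q`); §5 the numbers for `(p, q) = (3, 5)`: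
  `488`, `2252`, `38`, `8`, `32`, `2`, **`480`**, **`2220`**, `2738` out of `2¹⁵ = 32768` types.

No named fact, no `sorry`; the two definitions are explicit finite-set constructions.

## References

* [Hazama2003CyclicCM] F. Hazama, J. Math. Sci. Univ. Tokyo 10 (2003) 581–598, Props. 4.1, 4.3–4.5, 4.7, Thm. 4.8,
  §6.
* [Kubota1965] T. Kubota, Trans. AMS 118 (1965), §4 Lemma 2.

## Provenance

Cell `pub-hodgecm2` (COR-CM), literature seat `lit-deligne-3` gen 18 (claim HAZAMA-CYCLIC-2PQ; count-neutral).
-/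

set_option autoImplicit false

noncomputable section

open scoped BigOperators
open Finset

namespace Literature.NumberTheory.ComplexMultiplication

namespace CyclicCMType

variable {G : Type*} [CommGroup G] [Fintype G] [DecidableEq G] {p q : ℕ} {ρ τ κ : G}

/-! ## §1 The `(0,1)`-matrix of a type and the type of a matrix (Prop. 4.1) -/

section Matrix

/-- **Row `y` of Hazama's `(0,1)`-matrix of `S`**: `{x ∈ ℤ/p : τˣκʸ ∈ S}` (`z_{ij} = ν(e_·)`, the positions of the
odd part `κʸ⟨τ⟩` occupied by `S`). [cite: Hazama2003CyclicCM, Prop. 4.3 (proof, (4.5))] -/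
def rowSet (p q : ℕ) [NeZero p] (Φ : Finset G) (τ κ : G) (y : ZMod q) : Finset (ZMod p) :=
  Finset.univ.filter fun x : ZMod p => τ ^ x.val * κ ^ y.val ∈ Φ

/-- **The type with prescribed rows** `r : ℤ/q → 𝒫(ℤ/p)`: `{τˣκʸ : x ∈ r(y)} ∪ {ρτˣκʸ : x ∉ r(y)}` (the inverse of
`S ↦ E(S)`, Prop. 4.1). [cite: Hazama2003CyclicCM, Prop. 4.1] -/
def typeOfRows (p q : ℕ) [NeZero p] [NeZero q] (ρ τ κ : G) (r : ZMod q → Finset (ZMod p)) : Finset G :=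
  Finset.univ.image fun xy : ZMod p × ZMod q =>
    if xy.1 ∈ r xy.2 then τ ^ xy.1.val * κ ^ xy.2.val else ρ * (τ ^ xy.1.val * κ ^ xy.2.val)

variable [NeZero p] [NeZero q]

omit [Fintype G] [NeZero q] in
/-- Membership in a row (unfolding). [cite: Hazama2003CyclicCM, Prop. 4.3 (proof)] -/
theorem mem_rowSet_iff (Φ : Finset G) (x : ZMod p) (y : ZMod q) :
    x ∈ rowSet p q Φ τ κ y ↔ τ ^ x.val * κ ^ y.val ∈ Φ := by
  simp [rowSet]

omit [Fintype G] [NeZero q] in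
/-- The row count is the size of the row. [cite: Hazama2003CyclicCM, Prop. 4.3 (proof, (4.5))] -/
theorem rowCount_eq_card_rowSet (Φ : Finset G) (y : ZMod q) :
    rowCount p q Φ τ κ y = (rowSet p q Φ τ κ y).card := rfl

/-- `τˣκʸ ∈ S(r) ↔ x ∈ r(y)`. [cite: Hazama2003CyclicCM, Prop. 4.1] -/
theorem pow_mul_pow_mem_typeOfRows_iff (hF : CyclicFrame p q ρ τ κ) (r : ZMod q → Finset (ZMod p)) (x : ZMod p)
    (y : ZMod q) : τ ^ x.val * κ ^ y.val ∈ typeOfRows p q ρ τ κ r ↔ x ∈ r y := by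
  unfold typeOfRows
  rw [Finset.mem_image]
  constructor
  · rintro ⟨⟨x', y'⟩, -, h⟩
    dsimp only at h
    split_ifs at h with hc
    · obtain ⟨rfl, rfl⟩ := Prod.mk.inj (hF.pow_mul_pow_injective h)
      exact hc
    · exact absurd h.symm (hF.pow_mul_pow_ne_rho_mul _ _ _ _)
  · intro hx
    exact ⟨(x, y), Finset.mem_univ _, by simp [hx]⟩

/-- `ρτˣκʸ ∈ S(r) ↔ x ∉ r(y)`. [cite: Hazama2003CyclicCM, Prop. 4.1] -/
theorem rho_mul_mem_typeOfRows_iff (hF : CyclicFrame p q ρ τ κ) (r : ZMod q → Finset (ZMod p)) (x : ZMod p)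
    (y : ZMod q) : ρ * (τ ^ x.val * κ ^ y.val) ∈ typeOfRows p q ρ τ κ r ↔ x ∉ r y := by
  unfold typeOfRows
  rw [Finset.mem_image]
  constructor
  · rintro ⟨⟨x', y'⟩, -, h⟩
    dsimp only at h
    split_ifs at h with hc
    · exact absurd h (hF.pow_mul_pow_ne_rho_mul _ _ _ _)
    · obtain ⟨rfl, rfl⟩ := Prod.mk.inj (hF.pow_mul_pow_injective (mul_left_cancel h))
      exact hc
  · intro hx
    exact ⟨(x, y), Finset.mem_univ _, by simp [hx]⟩

/-- **`S(r)` is a CM type for `ρ`** (every element of `G` is `τˣκʸ` or `ρτˣκʸ`, and exactly one of the two lies in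
`S(r)`). [cite: Hazama2003CyclicCM, Prop. 4.1] -/
theorem isCMTypeWith_typeOfRows (hF : CyclicFrame p q ρ τ κ) (r : ZMod q → Finset (ZMod p)) :
    IsCMTypeWith ρ (typeOfRows p q ρ τ κ r : Set G) := by
  refine ⟨fun g => ?_, fun g x => ?_, fun x => ?_⟩
  · obtain ⟨⟨x, y⟩, rfl | rfl⟩ := hF.exists_coord g
    · rw [Finset.mem_coe, smul_eq_mul, Finset.mem_coe, pow_mul_pow_mem_typeOfRows_iff hF,
        rho_mul_mem_typeOfRows_iff hF, not_not]
    · rw [Finset.mem_coe, smul_eq_mul, Finset.mem_coe,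
        show ρ * (ρ * (τ ^ x.val * κ ^ y.val)) = τ ^ x.val * κ ^ y.val by
          rw [← mul_assoc, hF.rho_mul_rho, one_mul],
        pow_mul_pow_mem_typeOfRows_iff hF, rho_mul_mem_typeOfRows_iff hF]
  · change g * (ρ * x) = ρ * (g * x)
    rw [mul_left_comm]
  · change ρ * (ρ * x) = x
    rw [← mul_assoc, hF.rho_mul_rho, one_mul]

/-- The rows of `S(r)` are `r`. [cite: Hazama2003CyclicCM, Prop. 4.1] -/
theorem rowSet_typeOfRows (hF : CyclicFrame p q ρ τ κ) (r : ZMod q → Finset (ZMod p)) :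
    rowSet p q (typeOfRows p q ρ τ κ r) τ κ = r := by
  funext y
  ext x
  rw [mem_rowSet_iff, pow_mul_pow_mem_typeOfRows_iff hF]

/-- A CM type is the type of its rows (`E` is injective). [cite: Hazama2003CyclicCM, Prop. 4.1] -/
theorem typeOfRows_rowSet (hF : CyclicFrame p q ρ τ κ) {Φ : Finset G} (h : IsCMTypeWith ρ (Φ : Set G)) :
    typeOfRows p q ρ τ κ (rowSet p q Φ τ κ) = Φ := by
  ext g
  obtain ⟨⟨x, y⟩, rfl | rfl⟩ := hF.exists_coord g
  · rw [pow_mul_pow_mem_typeOfRows_iff hF, mem_rowSet_iff]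
  · rw [rho_mul_mem_typeOfRows_iff hF, mem_rowSet_iff, rho_mul_mem_iff h]

/-- Counting a set cut out of a finite type by a predicate. [folklore] -/
private theorem ncard_setOf_eq_card_filter' {α : Type*} [Fintype α] (P : α → Prop) [DecidablePred P] :
    {a : α | P a}.ncard = (Finset.univ.filter P).card := by
  rw [← Set.ncard_coe_finset]
  congr 1
  ext a
  simp

/-- **PROP. 4.1 as a transport of counts**: for predicates `P` on types and `Q` on row functions that agree under
`S ↦ rows(S)`, `#{S CM type : P(S)} = #{r : Q(r)}`. [cite: Hazama2003CyclicCM, Prop. 4.1] -/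
theorem ncard_cmTypes_sep_eq_card_filter (hF : CyclicFrame p q ρ τ κ) (P : Finset G → Prop)
    (Q : (ZMod q → Finset (ZMod p)) → Prop) [DecidablePred Q]
    (hPQ : ∀ Φ : Finset G, IsCMTypeWith ρ (Φ : Set G) → (P Φ ↔ Q (rowSet p q Φ τ κ))) :
    {Φ : Finset G | IsCMTypeWith ρ (Φ : Set G) ∧ P Φ}.ncard = (Finset.univ.filter Q).card := by
  classical
  rw [ncard_setOf_eq_card_filter']
  refine Finset.card_bij (fun Φ _ => rowSet p q Φ τ κ) (fun Φ hΦ => ?_) (fun Φ₁ h₁ Φ₂ h₂ h => ?_)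
    (fun r hr => ?_)
  · rw [Finset.mem_filter] at hΦ ⊢
    exact ⟨Finset.mem_univ _, (hPQ Φ hΦ.2.1).1 hΦ.2.2⟩
  · rw [Finset.mem_filter] at h₁ h₂
    rw [← typeOfRows_rowSet hF h₁.2.1, ← typeOfRows_rowSet hF h₂.2.1, h]
  · rw [Finset.mem_filter] at hr
    refine ⟨typeOfRows p q ρ τ κ r, ?_, rowSet_typeOfRows hF r⟩
    rw [Finset.mem_filter]
    refine ⟨Finset.mem_univ _, isCMTypeWith_typeOfRows hF r, ?_⟩
    rw [hPQ _ (isCMTypeWith_typeOfRows hF r), rowSet_typeOfRows hF]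
    exact hr.2

/-- **PROP. 4.1, the count: there are `2^{pq}` CM types** for `ρ` on the group of order `2pq`.
[cite: Hazama2003CyclicCM, Prop. 4.1] -/
theorem ncard_cmTypes (hF : CyclicFrame p q ρ τ κ) :
    {Φ : Finset G | IsCMTypeWith ρ (Φ : Set G)}.ncard = 2 ^ (p * q) := by
  classical
  have h := ncard_cmTypes_sep_eq_card_filter hF (fun _ => True) (fun _ => True) fun _ _ => Iff.rfl
  simp only [and_true, Finset.filter_true_of_mem (fun _ _ => trivial), Finset.card_univ, Fintype.card_fun,
    Fintype.card_finset, ZMod.card] at h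
  rw [h, ← pow_mul]

end Matrix

/-! ## §2 Hazama's three classes read on the rows -/

section Dictionary

variable [NeZero p] [NeZero q] {Φ : Finset G}

omit [Fintype G] [NeZero q] in
/-- `S ∈ S_p` iff the rows have constant size (definition of `HasConstantRows`). [cite: Hazama2003CyclicCM, Prop. 4.3] -/
theorem hasConstantRows_iff_rowSet :
    HasConstantRows p q Φ τ κ ↔ ∀ y y' : ZMod q, (rowSet p q Φ τ κ y).card = (rowSet p q Φ τ κ y').card :=
  Iff.rfl

omit [NeZero q] in
/-- **Prop. 4.7 (`r = p`): `κS = S` iff all rows of the matrix are EQUAL** (`E(S)` constant on the classes mod `p`).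
[cite: Hazama2003CyclicCM, Prop. 4.7] -/
theorem isStableUnder_right_iff_rowSet (hF : CyclicFrame p q ρ τ κ) (h : IsCMTypeWith ρ (Φ : Set G)) :
    IsStableUnder Φ κ ↔ ∀ y y' : ZMod q, rowSet p q Φ τ κ y = rowSet p q Φ τ κ y' := by
  rw [← forall_signMatrix_eq_right_iff hF h]
  simp only [signMatrix, typeSign_eq_typeSign_iff, Finset.ext_iff, mem_rowSet_iff]
  exact ⟨fun H y y' x => H x y y', fun H x y y' => H y y' x⟩

/-- A subset of `ℤ/p` all of whose points are simultaneously in or out is `∅` or everything. [folklore] -/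
private theorem eq_empty_or_univ_iff (A : Finset (ZMod p)) :
    (A = ∅ ∨ A = Finset.univ) ↔ ∀ x x' : ZMod p, (x ∈ A ↔ x' ∈ A) := by
  constructor
  · rintro (rfl | rfl) x x' <;> simp
  · intro H
    by_cases h0 : (0 : ZMod p) ∈ A
    · exact Or.inr (Finset.eq_univ_iff_forall.2 fun x => (H x 0).2 h0)
    · exact Or.inl (Finset.eq_empty_iff_forall_notMem.2 fun x hx => h0 ((H x 0).1 hx))

omit [NeZero q] in
/-- **Prop. 4.7 (`r = q`): `τS = S` iff every row is `∅` or all of `ℤ/p`** (`E(S)` constant on the classes mod `q`).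
[cite: Hazama2003CyclicCM, Prop. 4.7] -/
theorem isStableUnder_left_iff_rowSet (hF : CyclicFrame p q ρ τ κ) (h : IsCMTypeWith ρ (Φ : Set G)) :
    IsStableUnder Φ τ ↔ ∀ y : ZMod q, rowSet p q Φ τ κ y = ∅ ∨ rowSet p q Φ τ κ y = Finset.univ := by
  rw [← forall_signMatrix_eq_left_iff hF h]
  simp only [signMatrix, typeSign_eq_typeSign_iff, eq_empty_or_univ_iff, mem_rowSet_iff]
  exact ⟨fun H y x x' => H x x' y, fun H x x' y => H y x x'⟩

omit [Fintype G] in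
/-- `S ∈ S_q` (constant COLUMN counts) read on the rows: `#{y : x ∈ r(y)}` does not depend on `x`.
[cite: Hazama2003CyclicCM, Prop. 4.4] -/
theorem hasConstantCols_iff_rowSet :
    HasConstantRows q p Φ κ τ ↔ ∀ x x' : ZMod p,
      (Finset.univ.filter fun y : ZMod q => x ∈ rowSet p q Φ τ κ y).card =
        (Finset.univ.filter fun y : ZMod q => x' ∈ rowSet p q Φ τ κ y).card := by
  have key : ∀ x : ZMod p, rowCount q p Φ κ τ x =
      (Finset.univ.filter fun y : ZMod q => x ∈ rowSet p q Φ τ κ y).card := fun x => by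
    unfold rowCount
    congr 1
    ext y
    simp only [Finset.mem_filter, Finset.mem_univ, true_and, mem_rowSet_iff, mul_comm (κ ^ y.val)]
  unfold HasConstantRows
  simp only [key]

end Dictionary

/-! ## §3 Counting row functions `r : ℤ/q → 𝒫(ℤ/p)` -/

section Counting

variable (p q : ℕ) [NeZero p] [NeZero q]

/-- Row functions with all rows of size `i` number `C(p,i)^q`. [cite: Hazama2003CyclicCM, Prop. 4.3] -/
theorem card_filter_rows_card_eq (i : ℕ) :
    (Finset.univ.filter fun r : ZMod q → Finset (ZMod p) => ∀ y, (r y).card = i).card = p.choose i ^ q := by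
  classical
  have h : (Finset.univ.filter fun r : ZMod q → Finset (ZMod p) => ∀ y, (r y).card = i) =
      Fintype.piFinset fun _ : ZMod q => Finset.univ.powersetCard i := by
    ext r
    simp only [Finset.mem_filter, Finset.mem_univ, true_and, Fintype.mem_piFinset, Finset.mem_powersetCard,
      Finset.subset_univ]
  rw [h, Fintype.card_piFinset, Finset.prod_const, Finset.card_powersetCard, Finset.card_univ, Finset.card_univ,
    ZMod.card, ZMod.card]

/-- **Row functions with rows of CONSTANT size number `Σ_{0≤i≤p} C(p,i)^q`** ("the `q × p` `(0,1)`-matrices with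
constant row sum"). [cite: Hazama2003CyclicCM, Prop. 4.3] -/
theorem card_filter_rows_card_const :
    (Finset.univ.filter fun r : ZMod q → Finset (ZMod p) => ∀ y y', (r y).card = (r y').card).card =
      ∑ i ∈ Finset.range (p + 1), p.choose i ^ q := by
  classical
  rw [Finset.card_eq_sum_card_fiberwise (f := fun r : ZMod q → Finset (ZMod p) => (r 0).card)
    (t := Finset.range (p + 1)) fun r _ => ?_]
  · refine Finset.sum_congr rfl fun i _ => ?_
    rw [← card_filter_rows_card_eq p q i, Finset.filter_filter]
    congr 1
    ext r
    simp only [Finset.mem_filter, Finset.mem_univ, true_and]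
    constructor
    · rintro ⟨H, h0⟩ y
      rw [H y 0, h0]
    · intro H
      exact ⟨fun y y' => by rw [H y, H y'], H 0⟩
  · simp only [Finset.coe_range, Set.mem_Iio]
    have := Finset.card_le_univ (r 0)
    rw [ZMod.card] at this
    omega

/-- CONSTANT row functions number `2^p` (Prop. 4.7, `#(S₁ ∩ S_p) = 2^p`). [cite: Hazama2003CyclicCM, Prop. 4.7 and Thm. 4.8] -/
theorem card_filter_rows_const :
    (Finset.univ.filter fun r : ZMod q → Finset (ZMod p) => ∀ y y', r y = r y').card = 2 ^ p := by
  classical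
  have h : (Finset.univ.filter fun r : ZMod q → Finset (ZMod p) => ∀ y y', r y = r y') =
      (Finset.univ : Finset (Finset (ZMod p))).image fun A => fun _ => A := by
    ext r
    simp only [Finset.mem_filter, Finset.mem_univ, true_and, Finset.mem_image]
    constructor
    · intro H
      exact ⟨r 0, funext fun y => H 0 y⟩
    · rintro ⟨A, rfl⟩ y y'
      rfl
  rw [h, Finset.card_image_of_injective _ fun A B hAB => by simpa using congrFun hAB 0, Finset.card_univ,
    Fintype.card_finset, ZMod.card]

/-- `∅ ≠ ℤ/p` as finite sets (`p ≠ 0`). [folklore] -/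
private theorem empty_ne_univ : (∅ : Finset (ZMod p)) ≠ Finset.univ := by
  intro h
  have := Finset.card_univ (α := ZMod p)
  rw [← h, Finset.card_empty, ZMod.card] at this
  exact NeZero.ne p this.symm

/-- Row functions with every row `∅` or `ℤ/p` number `2^q` (Prop. 4.7, `#(S₁ ∩ S_q) = 2^q`).
[cite: Hazama2003CyclicCM, Prop. 4.7 and Thm. 4.8] -/
theorem card_filter_rows_trivial :
    (Finset.univ.filter fun r : ZMod q → Finset (ZMod p) => ∀ y, r y = ∅ ∨ r y = Finset.univ).card = 2 ^ q := by
  classical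
  have h : (Finset.univ.filter fun r : ZMod q → Finset (ZMod p) => ∀ y, r y = ∅ ∨ r y = Finset.univ) =
      Fintype.piFinset fun _ : ZMod q => ({∅, Finset.univ} : Finset (Finset (ZMod p))) := by
    ext r
    simp only [Finset.mem_filter, Finset.mem_univ, true_and, Fintype.mem_piFinset, Finset.mem_insert,
      Finset.mem_singleton]
  rw [h, Fintype.card_piFinset, Finset.prod_const, Finset.card_pair (empty_ne_univ p), Finset.card_univ, ZMod.card]

/-- Constant row functions with value `∅` or `ℤ/p` number `2` (`S_even`, `S_odd`: `#(S_p ∩ S_q) = 2`).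
[cite: Hazama2003CyclicCM, Prop. 4.5] -/
theorem card_filter_rows_const_and_trivial :
    (Finset.univ.filter fun r : ZMod q → Finset (ZMod p) =>
        (∀ y y', r y = r y') ∧ ∀ y, r y = ∅ ∨ r y = Finset.univ).card = 2 := by
  classical
  have h : (Finset.univ.filter fun r : ZMod q → Finset (ZMod p) =>
      (∀ y y', r y = r y') ∧ ∀ y, r y = ∅ ∨ r y = Finset.univ) =
      ({fun _ => ∅, fun _ => Finset.univ} : Finset (ZMod q → Finset (ZMod p))) := by
    ext r
    simp only [Finset.mem_filter, Finset.mem_univ, true_and, Finset.mem_insert, Finset.mem_singleton]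
    constructor
    · rintro ⟨H, H'⟩
      rcases H' 0 with h0 | h0
      · exact Or.inl (funext fun y => by rw [H y 0, h0])
      · exact Or.inr (funext fun y => by rw [H y 0, h0])
    · rintro (rfl | rfl)
      · exact ⟨fun _ _ => rfl, fun _ => Or.inl rfl⟩
      · exact ⟨fun _ _ => rfl, fun _ => Or.inr rfl⟩
  rw [h, Finset.card_pair]
  intro e
  exact empty_ne_univ p (congrFun e 0)

/-- Row functions that are constant OR have every row `∅`/`ℤ/p` number `2^p + 2^q − 2` (`#S₁`).
[cite: Hazama2003CyclicCM, Thm. 4.8] -/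
theorem card_filter_rows_const_or_trivial :
    (Finset.univ.filter fun r : ZMod q → Finset (ZMod p) =>
        (∀ y y', r y = r y') ∨ ∀ y, r y = ∅ ∨ r y = Finset.univ).card = 2 ^ p + 2 ^ q - 2 := by
  classical
  have h := Finset.card_union_add_card_inter
    (Finset.univ.filter fun r : ZMod q → Finset (ZMod p) => ∀ y y', r y = r y')
    (Finset.univ.filter fun r : ZMod q → Finset (ZMod p) => ∀ y, r y = ∅ ∨ r y = Finset.univ)
  rw [← Finset.filter_or, ← Finset.filter_and, card_filter_rows_const, card_filter_rows_trivial,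
    card_filter_rows_const_and_trivial] at h
  omega

/-- (Constant or trivial) AND constant size ⟺ constant (`S₁ ∩ S_p` = the `κ`-stable types): `2^p` of them.
[cite: Hazama2003CyclicCM, Prop. 4.7] -/
theorem card_filter_rows_const_or_trivial_and_card_const :
    (Finset.univ.filter fun r : ZMod q → Finset (ZMod p) =>
        ((∀ y y', r y = r y') ∨ ∀ y, r y = ∅ ∨ r y = Finset.univ) ∧ ∀ y y', (r y).card = (r y').card).card =
      2 ^ p := by
  classical
  rw [← card_filter_rows_const p q]
  congr 1
  refine Finset.filter_congr fun r _ => ⟨?_, fun H => ⟨Or.inl H, fun y y' => by rw [H y y']⟩⟩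
  rintro ⟨H | H, Hc⟩
  · exact H
  · intro y y'
    rcases H y with hy | hy <;> rcases H y' with hy' | hy'
    · rw [hy, hy']
    · exfalso
      have := Hc y y'
      rw [hy, hy', Finset.card_empty, Finset.card_univ, ZMod.card] at this
      exact NeZero.ne p this.symm
    · exfalso
      have := Hc y y'
      rw [hy, hy', Finset.card_empty, Finset.card_univ, ZMod.card] at this
      exact NeZero.ne p this
    · rw [hy, hy']

end Counting

/-! ## §4 The counts of Theorem 4.8 -/

section Counts

variable [NeZero p] [NeZero q]

/-- **PROP. 4.3, the count: `#S_p = Σ_{0≤i≤p} C(p,i)^q`** (types with constant row counts; `S_p` is this class by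
`sum_char_eq_zero_iff_hasConstantRows`). [cite: Hazama2003CyclicCM, Prop. 4.3 and Thm. 4.8] -/
theorem ncard_hasConstantRows (hF : CyclicFrame p q ρ τ κ) :
    {Φ : Finset G | IsCMTypeWith ρ (Φ : Set G) ∧ HasConstantRows p q Φ τ κ}.ncard =
      ∑ i ∈ Finset.range (p + 1), p.choose i ^ q := by
  classical
  rw [← card_filter_rows_card_const p q]
  exact ncard_cmTypes_sep_eq_card_filter hF _ _ fun Φ _ => hasConstantRows_iff_rowSet

/-- **PROP. 4.4, the count: `#S_q = Σ_{0≤i≤q} C(q,i)^p`.** [cite: Hazama2003CyclicCM, Prop. 4.4 and Thm. 4.8] -/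
theorem ncard_hasConstantCols (hF : CyclicFrame p q ρ τ κ) :
    {Φ : Finset G | IsCMTypeWith ρ (Φ : Set G) ∧ HasConstantRows q p Φ κ τ}.ncard =
      ∑ i ∈ Finset.range (q + 1), q.choose i ^ p :=
  ncard_hasConstantRows hF.swap

/-- **`#S₁ = 2^p + 2^q − 2`** (the non-primitive types, Thm. 4.8 (iii): stable under `τ` or under `κ`).
[cite: Hazama2003CyclicCM, Thm. 4.8] -/
theorem ncard_stable (hF : CyclicFrame p q ρ τ κ) :
    {Φ : Finset G | IsCMTypeWith ρ (Φ : Set G) ∧ (IsStableUnder Φ τ ∨ IsStableUnder Φ κ)}.ncard =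
      2 ^ p + 2 ^ q - 2 := by
  classical
  rw [← card_filter_rows_const_or_trivial p q]
  refine ncard_cmTypes_sep_eq_card_filter hF _ _ fun Φ h => ?_
  rw [isStableUnder_left_iff_rowSet hF h, isStableUnder_right_iff_rowSet hF h, or_comm]

/-- **`#(S₁ ∩ S_p) = 2^p`** (Prop. 4.7: these are the `κ`-stable types). [cite: Hazama2003CyclicCM, Prop. 4.7 and Thm. 4.8] -/
theorem ncard_stable_and_hasConstantRows (hF : CyclicFrame p q ρ τ κ) :
    {Φ : Finset G | IsCMTypeWith ρ (Φ : Set G) ∧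
        ((IsStableUnder Φ τ ∨ IsStableUnder Φ κ) ∧ HasConstantRows p q Φ τ κ)}.ncard = 2 ^ p := by
  classical
  rw [← card_filter_rows_const_or_trivial_and_card_const p q]
  refine ncard_cmTypes_sep_eq_card_filter hF _ _ fun Φ h => ?_
  rw [isStableUnder_left_iff_rowSet hF h, isStableUnder_right_iff_rowSet hF h, hasConstantRows_iff_rowSet, or_comm]

/-- **`#(S₁ ∩ S_q) = 2^q`.** [cite: Hazama2003CyclicCM, Prop. 4.7 and Thm. 4.8] -/
theorem ncard_stable_and_hasConstantCols (hF : CyclicFrame p q ρ τ κ) :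
    {Φ : Finset G | IsCMTypeWith ρ (Φ : Set G) ∧
        ((IsStableUnder Φ τ ∨ IsStableUnder Φ κ) ∧ HasConstantRows q p Φ κ τ)}.ncard = 2 ^ q := by
  have h := ncard_stable_and_hasConstantRows hF.swap
  simp_rw [or_comm (a := IsStableUnder _ κ)] at h
  exact h

/-- **PROP. 4.5, the count: `#(S_p ∩ S_q) = 2`** (`S_even` and `S_odd`, i.e. `⟨τ, κ⟩` and `ρ⟨τ, κ⟩`).
[cite: Hazama2003CyclicCM, Prop. 4.5 and Thm. 4.8] -/
theorem ncard_hasConstantRows_and_hasConstantCols (hF : CyclicFrame p q ρ τ κ) :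
    {Φ : Finset G | IsCMTypeWith ρ (Φ : Set G) ∧
        (HasConstantRows p q Φ τ κ ∧ HasConstantRows q p Φ κ τ)}.ncard = 2 := by
  classical
  rw [← card_filter_rows_const_and_trivial p q]
  refine ncard_cmTypes_sep_eq_card_filter hF _ _ fun Φ h => ?_
  rw [← isStableUnder_left_iff_rowSet hF h, ← isStableUnder_right_iff_rowSet hF h]
  constructor
  · rintro ⟨hr, hc⟩
    exact (isStableUnder_and_of_hasConstantRows hF h hr hc).symm
  · rintro ⟨hκ, hτ⟩
    exact ⟨((isStableUnder_right_iff hF h).1 hκ).2, ((isStableUnder_right_iff hF.swap h).1 hτ).2⟩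

/-- `#(S₁ ∩ S_p ∩ S_q) = #(S_p ∩ S_q) = 2` (`S_p ∩ S_q ⊆ S₁`). [cite: Hazama2003CyclicCM, Prop. 4.5 and Thm. 4.8] -/
theorem ncard_stable_and_hasConstantRows_and_hasConstantCols (hF : CyclicFrame p q ρ τ κ) :
    {Φ : Finset G | IsCMTypeWith ρ (Φ : Set G) ∧
        ((IsStableUnder Φ τ ∨ IsStableUnder Φ κ) ∧ HasConstantRows p q Φ τ κ ∧ HasConstantRows q p Φ κ τ)}.ncard =
      2 := by
  rw [← ncard_hasConstantRows_and_hasConstantCols hF]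
  congr 1
  ext Φ
  simp only [Set.mem_setOf_eq]
  refine ⟨fun ⟨h, _, hr, hc⟩ => ⟨h, hr, hc⟩, fun ⟨h, hr, hc⟩ => ⟨h, ?_, hr, hc⟩⟩
  exact Or.inl (isStableUnder_and_of_hasConstantRows hF h hr hc).1

/-- **THEOREM 4.8 (iv), the count: the PRIMITIVE `p`-dominated types number `Σ_{0≤i≤p} C(p,i)^q − 2^p`**
(`#(S_p − S₁)`; for `(p,q) = (3,5)`: `480`, §6). [cite: Hazama2003CyclicCM, Thm. 4.8 (iv) and §6 (p. 597)] -/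
theorem ncard_primitive_hasConstantRows (hF : CyclicFrame p q ρ τ κ) :
    {Φ : Finset G | IsCMTypeWith ρ (Φ : Set G) ∧
        (HasConstantRows p q Φ τ κ ∧ ∀ u : G, u ≠ 1 → ¬ IsStableUnder Φ u)}.ncard =
      ∑ i ∈ Finset.range (p + 1), p.choose i ^ q - 2 ^ p := by
  classical
  -- primitive = not (stable under `τ` or `κ`) (Prop. 2.3), then complement inside `S_p`
  have hsplit := Finset.card_filter_add_card_filter_not
    (s := Finset.univ.filter fun r : ZMod q → Finset (ZMod p) => ∀ y y', (r y).card = (r y').card)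
    (fun r : ZMod q → Finset (ZMod p) => (∀ y y', r y = r y') ∨ ∀ y, r y = ∅ ∨ r y = Finset.univ)
  rw [Finset.filter_filter, Finset.filter_filter, card_filter_rows_card_const] at hsplit
  have h1 : (Finset.univ.filter fun r : ZMod q → Finset (ZMod p) =>
      (∀ y y', (r y).card = (r y').card) ∧ ((∀ y y', r y = r y') ∨ ∀ y, r y = ∅ ∨ r y = Finset.univ)).card =
      2 ^ p := by
    rw [← card_filter_rows_const_or_trivial_and_card_const p q]
    congr 1
    exact Finset.filter_congr fun r _ => and_comm
  rw [h1] at hsplit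
  have h2 : {Φ : Finset G | IsCMTypeWith ρ (Φ : Set G) ∧
      (HasConstantRows p q Φ τ κ ∧ ∀ u : G, u ≠ 1 → ¬ IsStableUnder Φ u)}.ncard =
      (Finset.univ.filter fun r : ZMod q → Finset (ZMod p) => (∀ y y', (r y).card = (r y').card) ∧
        ¬ ((∀ y y', r y = r y') ∨ ∀ y, r y = ∅ ∨ r y = Finset.univ)).card := by
    refine ncard_cmTypes_sep_eq_card_filter hF _ _ fun Φ h => ?_
    rw [hasConstantRows_iff_rowSet, ← isStableUnder_left_iff_rowSet hF h, ← isStableUnder_right_iff_rowSet hF h,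
      or_comm, ← exists_isStableUnder_iff hF h]
    simp only [ne_eq, not_exists, not_and]
  rw [h2]
  omega

/-- **THEOREM 4.8 (v), the count: the primitive `q`-dominated types number `Σ_{0≤i≤q} C(q,i)^p − 2^q`**
(`2220` for `(p,q) = (3,5)`). [cite: Hazama2003CyclicCM, Thm. 4.8 (v) and §6 (p. 598)] -/
theorem ncard_primitive_hasConstantCols (hF : CyclicFrame p q ρ τ κ) :
    {Φ : Finset G | IsCMTypeWith ρ (Φ : Set G) ∧
        (HasConstantRows q p Φ κ τ ∧ ∀ u : G, u ≠ 1 → ¬ IsStableUnder Φ u)}.ncard =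
      ∑ i ∈ Finset.range (q + 1), q.choose i ^ p - 2 ^ q :=
  ncard_primitive_hasConstantRows hF.swap

/-- **`#Deg = Σ_{i≤p} C(p,i)^q + Σ_{i≤q} C(q,i)^p − 2`**: by Thm. 4.8 (ii) `Deg = S₁ ∪ S_p ∪ S_q`, and
`S₁ ⊆ S_p ∪ S_q` (a `κ`-stable type has constant rows, a `τ`-stable one constant columns, Prop. 4.7), so
`Deg = S_p ∪ S_q` with `#(S_p ∩ S_q) = 2`. [cite: Hazama2003CyclicCM, Thm. 4.8 (ii) and Prop. 4.5, 4.7] -/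
theorem ncard_degenerate (hF : CyclicFrame p q ρ τ κ) :
    {Φ : Finset G | IsCMTypeWith ρ (Φ : Set G) ∧ typeRank G (Φ : Set G) ≠ p * q + 1}.ncard + 2 =
      ∑ i ∈ Finset.range (p + 1), p.choose i ^ q + ∑ i ∈ Finset.range (q + 1), q.choose i ^ p := by
  classical
  -- on row functions: `Rows ∨ Cols`
  let R : (ZMod q → Finset (ZMod p)) → Prop := fun r => ∀ y y', (r y).card = (r y').card
  let C : (ZMod q → Finset (ZMod p)) → Prop := fun r => ∀ x x' : ZMod p,
    (Finset.univ.filter fun y : ZMod q => x ∈ r y).card = (Finset.univ.filter fun y : ZMod q => x' ∈ r y).card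
  have hR : (Finset.univ.filter R).card = ∑ i ∈ Finset.range (p + 1), p.choose i ^ q :=
    card_filter_rows_card_const p q
  have hC : (Finset.univ.filter C).card = ∑ i ∈ Finset.range (q + 1), q.choose i ^ p := by
    rw [← ncard_hasConstantCols hF]
    exact (ncard_cmTypes_sep_eq_card_filter hF _ C fun Φ _ => hasConstantCols_iff_rowSet).symm
  have hRC : (Finset.univ.filter fun r => R r ∧ C r).card = 2 := by
    rw [← ncard_hasConstantRows_and_hasConstantCols hF]
    exact (ncard_cmTypes_sep_eq_card_filter hF _ _ fun Φ _ =>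
      and_congr hasConstantRows_iff_rowSet hasConstantCols_iff_rowSet).symm
  have hdeg : {Φ : Finset G | IsCMTypeWith ρ (Φ : Set G) ∧ typeRank G (Φ : Set G) ≠ p * q + 1}.ncard =
      (Finset.univ.filter fun r => R r ∨ C r).card := by
    refine ncard_cmTypes_sep_eq_card_filter hF _ _ fun Φ h => ?_
    rw [typeRank_ne_iff hF h]
    have eR : R (rowSet p q Φ τ κ) ↔ HasConstantRows p q Φ τ κ := hasConstantRows_iff_rowSet.symm
    have eC : C (rowSet p q Φ τ κ) ↔ HasConstantRows q p Φ κ τ := hasConstantCols_iff_rowSet.symm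
    rw [eR, eC]
    constructor
    · rintro (hr | hc | hτ | hκ)
      · exact Or.inl hr
      · exact Or.inr hc
      · exact Or.inr ((isStableUnder_right_iff hF.swap h).1 hτ).2
      · exact Or.inl ((isStableUnder_right_iff hF h).1 hκ).2
    · rintro (hr | hc)
      · exact Or.inl hr
      · exact Or.inr (Or.inl hc)
  have hie := Finset.card_union_add_card_inter (Finset.univ.filter R) (Finset.univ.filter C)
  rw [← Finset.filter_or, ← Finset.filter_and, hR, hC, hRC] at hie
  rw [hdeg]
  exact hie

end Counts

/-! ## §5 The numbers for `(p, q) = (3, 5)` (a cyclic CM field of degree `30`, e.g. `ℚ(ζ₃₁)`) -/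

section ThreeFive

variable {ρ τ κ : G}

/-- `Σ_{i≤3} C(3,i)⁵ = 488`, `Σ_{i≤5} C(5,i)³ = 2252`. [cite: Hazama2003CyclicCM, §6 (p. 597–598)] -/
theorem sums_three_five :
    ∑ i ∈ Finset.range (3 + 1), (3 : ℕ).choose i ^ 5 = 488 ∧ ∑ i ∈ Finset.range (5 + 1), (5 : ℕ).choose i ^ 3 = 2252 := by
  decide

/-- **The numbers of Theorem 4.8 for `(p, q) = (3, 5)`**: `#S₃ = 488`, `#S₅ = 2252`, `#S₁ = 38`, `#(S₁ ∩ S₃) = 8`,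
`#(S₁ ∩ S₅) = 32`, `#(S₃ ∩ S₅) = 2`, out of `2¹⁵ = 32768` CM types; **`480` primitive `3`-dominated and `2220`
primitive `5`-dominated types** (§6), and `2738` degenerate types in all.
[cite: Hazama2003CyclicCM, Thm. 4.8 and §6 (p. 597–598)] -/
theorem counts_three_five (hF : CyclicFrame 3 5 ρ τ κ) :
    {Φ : Finset G | IsCMTypeWith ρ (Φ : Set G)}.ncard = 32768 ∧
    {Φ : Finset G | IsCMTypeWith ρ (Φ : Set G) ∧ HasConstantRows 3 5 Φ τ κ}.ncard = 488 ∧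
    {Φ : Finset G | IsCMTypeWith ρ (Φ : Set G) ∧ HasConstantRows 5 3 Φ κ τ}.ncard = 2252 ∧
    {Φ : Finset G | IsCMTypeWith ρ (Φ : Set G) ∧ (IsStableUnder Φ τ ∨ IsStableUnder Φ κ)}.ncard = 38 ∧
    {Φ : Finset G | IsCMTypeWith ρ (Φ : Set G) ∧
        ((IsStableUnder Φ τ ∨ IsStableUnder Φ κ) ∧ HasConstantRows 3 5 Φ τ κ)}.ncard = 8 ∧
    {Φ : Finset G | IsCMTypeWith ρ (Φ : Set G) ∧
        ((IsStableUnder Φ τ ∨ IsStableUnder Φ κ) ∧ HasConstantRows 5 3 Φ κ τ)}.ncard = 32 ∧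
    {Φ : Finset G | IsCMTypeWith ρ (Φ : Set G) ∧
        (HasConstantRows 3 5 Φ τ κ ∧ HasConstantRows 5 3 Φ κ τ)}.ncard = 2 ∧
    {Φ : Finset G | IsCMTypeWith ρ (Φ : Set G) ∧
        (HasConstantRows 3 5 Φ τ κ ∧ ∀ u : G, u ≠ 1 → ¬ IsStableUnder Φ u)}.ncard = 480 ∧
    {Φ : Finset G | IsCMTypeWith ρ (Φ : Set G) ∧
        (HasConstantRows 5 3 Φ κ τ ∧ ∀ u : G, u ≠ 1 → ¬ IsStableUnder Φ u)}.ncard = 2220 ∧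
    {Φ : Finset G | IsCMTypeWith ρ (Φ : Set G) ∧ typeRank G (Φ : Set G) ≠ 3 * 5 + 1}.ncard = 2738 := by
  refine ⟨?_, ?_, ?_, ?_, ?_, ?_, ?_, ?_, ?_, ?_⟩
  · rw [ncard_cmTypes hF]; norm_num
  · rw [ncard_hasConstantRows hF, sums_three_five.1]
  · rw [ncard_hasConstantCols hF, sums_three_five.2]
  · rw [ncard_stable hF]; norm_num
  · rw [ncard_stable_and_hasConstantRows hF]; norm_num
  · rw [ncard_stable_and_hasConstantCols hF]; norm_num
  · rw [ncard_hasConstantRows_and_hasConstantCols hF]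
  · rw [ncard_primitive_hasConstantRows hF, sums_three_five.1]; norm_num
  · rw [ncard_primitive_hasConstantCols hF, sums_three_five.2]; norm_num
  · have h := ncard_degenerate hF
    rw [sums_three_five.1, sums_three_five.2] at h
    omega

end ThreeFive

end CyclicCMType

end Literature.NumberTheory.ComplexMultiplication

end
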